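import Summits.BirchSwinnertonDyer.BirchSwinnertonDyer.Theorems.GenusKolyvaginAtTwoPowDvdShaCardAtTwoRTTwoClassChebotarev
import Summits.BirchSwinnertonDyer.BirchSwinnertonDyer.Theorems.GenusKolyvaginAtTwoPowDvdShaCardAtTwoRTPrimeSwappingWeak
import HarnessLib

/-!
# Route `GenusKolyvaginAtTwo`, crux L_T `PowDvdShaCardAtTwoRT` (stmt-BirchSwinnertonDyer-23242), LINE 18/19 stub 3a⁗, step (b):
# the MIXED-PAIR Čebotarev of the repaired swap — an order-`2` class made non-zero and a class of order `2^κ` given FULL local order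

Seat `bsd-line-gk2-p2` g16 (PROVER seat 2/3, cell `bsd-f1-sign2`), `--supports 23242 --as helper`; sequel of `…RTTwoClassChebotarev`
(the order-`2` pair) and `…RTPrimeSwappingWeak` (socle lemmas). THEOREMS ONLY. BSD is not proved by any of this; neither is the crux.

Memo `Cruxes/PowDvdShaCardAtTwoRT/Lines/plus-descent-step-b-prop52.md`, Addendum 3 (F1)–(F2): in McCallum's swap (proof of Prop. 5.2,
(10)–(13)) the auxiliary class must have ORDER `≥ p^{M_r+1}` and the Čebotarev prime `l′` must give it FULL local order at `λ′` (so that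
the `λ′`-term of the level-`L` reciprocity sum is non-zero: in the cyclic local duality `⟨d, x⟩ ≠ 0 ⟺ ord d · ord x > p^L`), while the
detected class `c_{M_r+1}(n)` (order `2` at `p = 2`) must merely be non-zero at `λ′`. This file is that prescription at `2`, from Q5R
`EquivariantChebotarevAtTwoR` BY NAME (`GenusExact.equivariantChebotarevAtTwo_of_not_isSquare`, p606279): for `x ≠ 0` with `2x = 0` and
`y` of order `2^κ` (`1 ≤ κ ≤ M`), both fixed by complex conjugation, with Q5R's separation hypothesis on `⟨x, y⟩`, infinitely many
Kolyvagin primes `ℓ` at `2` of index `≥ M`, `Frob_ℓ = Frob_∞` on `K(E[2^M])`, with `x_λ ≠ 0` AND `ord y_λ = 2^κ` (in the tree's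
currency: `2^j y ∈ torsionLocalKer_λ ⟺ κ ≤ j`). No Klein four: if `x` is the socle `2^{κ−1}y` of `⟨y⟩` the single class `y` does it,
otherwise `{x, y}` is an independent pair (§1).

* §1 `eq_pow_pred_nsmul_of_mem_zmultiples` (an order-`2` element of `⟨y⟩`, `ord y = 2^κ`, IS `2^{κ−1}y`),
  `dvd_of_zsmul_add_zsmul_eq_zero_of_ne_socle` (independence of `{x, y}` when `x ≠ 2^{κ−1}y`);
* §2 **`infinite_kolyvaginPrime_localization_mixed_pair`**.

References: [McCallumLMS1991] §3 Cor. 3.2; §5 proof of Prop. 5.2, (10)–(13).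
-/

set_option autoImplicit false
-- `Summit.<P>.<Sub>` repeats `BirchSwinnertonDyer` by the tree's layout convention (D-0017)
set_option linter.dupNamespace false

noncomputable section

open scoped Classical

namespace Summit.BirchSwinnertonDyer.BirchSwinnertonDyer.Theorems.GenusExact.PlusDescent

open WeierstrassCurve NumberField IsDedekindDomain Field
open Literature.NumberTheory.GaloisRepresentations Literature.NumberTheory.EllipticCurves
open Literature.NumberTheory

/-! ## §1 The socle of `⟨y⟩` and independence of a mixed pair -/

section Socle

variable {A : Type*} [AddCommGroup A]

/-- **A non-zero element of `⟨y⟩` killed by `2`, `ord y = 2^κ` (`κ ≥ 1`), is the socle generator `2^{κ−1}·y`**: the elements of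
`⟨y⟩` killed by `2` form a group of order `∣ 2` (`mem_zmultiples_of_socle`), containing `2^{κ−1}y ≠ 0` (`pow_pred_nsmul_socle`), and
`⟨x⟩ = {0, x}`. [folklore] -/
theorem eq_pow_pred_nsmul_of_mem_zmultiples {x y : A} (hx : 2 • x = 0) (hx0 : x ≠ 0) {κ : ℕ} (hκ : 1 ≤ κ)
    (hy : addOrderOf y = 2 ^ κ) (hmem : x ∈ AddSubgroup.zmultiples y) : x = 2 ^ (κ - 1) • y := by
  obtain ⟨hγ0, hγ2, hγmem⟩ := pow_pred_nsmul_socle hκ hy Nat.prime_two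
  -- the socle generator lies in `⟨x⟩ = {0, x}`
  have hγx : 2 ^ (κ - 1) • y ∈ AddSubgroup.zmultiples x :=
    mem_zmultiples_of_socle Nat.prime_two hγmem hγ2 hmem hx hx0
  rw [AddSubgroup.mem_zmultiples_iff] at hγx
  obtain ⟨k, hk⟩ := hγx
  rcases Int.even_or_odd k with hk2 | hk2
  · rw [zsmul_eq_zero_of_even_of_two_nsmul_eq_zero hx hk2] at hk
    exact absurd hk.symm hγ0
  · rw [zsmul_eq_self_of_odd_of_two_nsmul_eq_zero hx hk2] at hk
    exact hk

/-- **Independence of the mixed pair off the socle** (McCallum's sense, §3): `2x = 0`, `x ≠ 0`, `ord y = 2^κ` (`κ ≥ 1`),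
`x ≠ 2^{κ−1}y`; then `a·x + b·y = 0` forces `2 ∣ a` and `2^κ ∣ b`. (If `a` were odd, `x = (−b)·y ∈ ⟨y⟩` would be the socle.)
[cite: McCallumLMS1991, §3 (definition before Cor. 3.2)] -/
theorem dvd_of_zsmul_add_zsmul_eq_zero_of_ne_socle {x y : A} (hx : 2 • x = 0) (hx0 : x ≠ 0) {κ : ℕ} (hκ : 1 ≤ κ)
    (hy : addOrderOf y = 2 ^ κ) (hxy : x ≠ 2 ^ (κ - 1) • y) {a b : ℤ} (h : a • x + b • y = 0) :
    (2 : ℤ) ∣ a ∧ ((2 ^ κ : ℕ) : ℤ) ∣ b := by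
  have ha : (2 : ℤ) ∣ a := by
    rcases Int.even_or_odd a with ha | ha
    · exact ha.two_dvd
    · exfalso
      rw [zsmul_eq_self_of_odd_of_two_nsmul_eq_zero hx ha] at h
      have hxb : x = (-b) • y := by rw [neg_smul, eq_neg_iff_add_eq_zero, h]
      exact hxy (eq_pow_pred_nsmul_of_mem_zmultiples hx hx0 hκ hy (hxb ▸ AddSubgroup.zsmul_mem _ (AddSubgroup.mem_zmultiples y) _))
  refine ⟨ha, ?_⟩
  rw [zsmul_eq_zero_of_even_of_two_nsmul_eq_zero hx (even_iff_two_dvd.mpr ha), zero_add] at h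
  rw [← hy]
  exact addOrderOf_dvd_iff_zsmul_eq_zero.mpr h

end Socle

/-! ## §2 The mixed-pair Čebotarev at `2` -/

section Chebotarev

/-- **THE MIXED-PAIR ČEBOTAREV AT `2` (input of the repaired swap, Addendum 3 (F2)(b)).** On the Q5R habitat (`E/ℚ` non-CM, `Δ < 0`,
`ρ_{E,2^∞}` onto; `K` imaginary quadratic with `K ≠ ℚ(√Δ_E)`; `c ≠ 1` in `Gal(K/ℚ)`; `M ≥ 1`): for `x ∈ H¹(K, E[2^M])` with `x ≠ 0`,
`2x = 0`, and `y` with `addOrderOf y = 2^κ`, `1 ≤ κ` (automatically `≤ M`), both FIXED by `c`, and Q5R's separation hypothesis on `⟨x, y⟩`, there are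
infinitely many Kolyvagin primes `ℓ` at `2` of index `≥ M` with `Frob_ℓ = Frob_∞` at whose place **`x_λ ≠ 0` and `y_λ` has order
exactly `2^κ`** (`2^j·y ∈ torsionLocalKer_λ ⟺ κ ≤ j`). In the swap: `x = c_{M_r+1}(n)`, `y` = the auxiliary class of order `2^κ ≥ 2^{M_r+2}`.
Proof: if `x = 2^{κ−1}y`, Q5R for `{y}` with `N = M_1 = κ` (then `x_λ = 2^{κ−1}y_λ ≠ 0`); else Q5R for the independent pair `{x, y}`
with `(N_i) = (M_i) = (1, κ)`. [cite: McCallumLMS1991, §3 Cor. 3.2; §5 Prop. 5.2 (proof, (11)–(13))] -/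
theorem infinite_kolyvaginPrime_localization_mixed_pair
    (N : ℕ) [NeZero N] (W : WeierstrassCurve ℚ) [W.IsElliptic] [W.IsGloballyMinimal]
    (hcm : ¬ W.HasCM) (hΔ : W.Δ < 0) (K : Type) [Field K] [NumberField K]
    (hK : IsImaginaryQuadratic K) (hns : ¬ IsSquare ((NumberField.discr K : ℚ) * -|W.Δ|))
    (hρ : ∀ n : ℕ, W.HasSurjectiveModNGaloisRep (2 ^ n : ℕ)) (c : K ≃ₐ[ℚ] K) (hc : c ≠ 1)
    (M : ℕ) (hM : 1 ≤ M) (x y : galH1Torsion (W.baseChange K) ((2 ^ M : ℕ) : ℤ))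
    (hx0 : x ≠ 0) (hx2 : 2 • x = 0) {κ : ℕ} (hκ : 1 ≤ κ) (hy : addOrderOf y = 2 ^ κ)
    (hτx : conjAct W c ((2 ^ M : ℕ) : ℤ) x = x) (hτy : conjAct W c ((2 ^ M : ℕ) : ℤ) y = y)
    (hres : ∀ a b : ℤ, (∀ ρ ∈ torsionFixing (W.baseChange K) ((2 ^ M : ℕ) : ℤ),
      h1Eval (W.baseChange K) ((2 ^ M : ℕ) : ℤ) (a • x + b • y) ρ = 0) → a • x + b • y = 0) :
    Set.Infinite {ℓ : ℕ | FrobEqFrobInfty W K (2 ^ M) ℓ ∧ Zhang2014.IsKolyvaginPrime N W K 2 ℓ ∧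
      M ≤ Zhang2014.kolyvaginIndex W 2 ℓ ∧
      ∀ v : HeightOneSpectrum (𝓞 K), (ℓ : 𝓞 K) ∈ v.asIdeal →
        x ∉ (W.baseChange K).torsionLocalKer (v.adicCompletion K) ((2 ^ M : ℕ) : ℤ) ∧
        ∀ j : ℕ, ((2 ^ j : ℕ) : ℤ) • y ∈ (W.baseChange K).torsionLocalKer (v.adicCompletion K) ((2 ^ M : ℕ) : ℤ) ↔ κ ≤ j} := by
  have hy0 : y ≠ 0 := by
    intro h
    rw [h, addOrderOf_zero] at hy
    have : 2 ≤ 2 ^ κ := by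
      calc (2 : ℕ) = 2 ^ 1 := (pow_one 2).symm
        _ ≤ 2 ^ κ := Nat.pow_le_pow_right (by norm_num) hκ
    omega
  by_cases hxy : x = 2 ^ (κ - 1) • y
  · -- the socle case: one class `y` with full prescribed order
    have hQ := equivariantChebotarevAtTwo_of_not_isSquare N W hcm hΔ K hK hns hρ c hc M hM 1 ![y] id
      (fun i ↦ by fin_cases i; exact hy0)
      (fun i ↦ by fin_cases i; exact hτy)
      (fun a ha i ↦ by
        fin_cases i
        simp only [Fin.sum_univ_one, Fin.isValue, Matrix.cons_val_zero] at ha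
        show ((addOrderOf y : ℕ) : ℤ) ∣ a 0
        rw [addOrderOf_dvd_iff_zsmul_eq_zero]
        exact ha)
      (fun a ha ↦ by
        simp only [Fin.sum_univ_one, Fin.isValue, Matrix.cons_val_zero] at ha ⊢
        have h := hres 0 (a 0) (fun ρ hρ' ↦ by rw [zero_smul, zero_add]; exact ha ρ hρ')
        rwa [zero_smul, zero_add] at h)
      ![κ] (fun i ↦ by fin_cases i; exact hy) ![κ]
      (fun i ↦ by fin_cases i; exact le_rfl) (fun _ ↦ rfl)
    refine hQ.mono fun ℓ hℓ ↦ ⟨hℓ.1, hℓ.2.1, hℓ.2.2.1, fun v hv ↦ ⟨fun hxv ↦ ?_, fun j ↦ ?_⟩⟩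
    · -- `x = 2^{κ-1} • y` would lie in the local kernel only if `κ ≤ κ - 1`
      have h := hℓ.2.2.2 0 v hv (κ - 1)
      have h' : (((2 ^ (κ - 1) : ℕ) : ℤ)) • y ∈
          (W.baseChange K).torsionLocalKer (v.adicCompletion K) ((2 ^ M : ℕ) : ℤ) := by
        rw [natCast_zsmul, ← hxy]
        exact hxv
      have hle : (![κ] : Fin 1 → ℕ) 0 ≤ κ - 1 := h.mp h'
      simp only [Matrix.cons_val_zero] at hle
      omega
    · have h := hℓ.2.2.2 0 v hv j
      simpa using h
  · -- off the socle: the independent pair `{x, y}`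
    have hord : ∀ i : Fin 2, addOrderOf (![x, y] i) = 2 ^ (![1, κ] : Fin 2 → ℕ) i := fun i ↦ by
      fin_cases i
      · exact addOrderOf_eq_two_pow_one hx2 hx0
      · exact hy
    have hQ := equivariantChebotarevAtTwo_of_not_isSquare N W hcm hΔ K hK hns hρ c hc M hM 2 ![x, y] id
      (fun i ↦ by fin_cases i <;> assumption)
      (fun i ↦ by fin_cases i <;> assumption)
      (fun a ha i ↦ by
        simp only [Fin.sum_univ_two, Fin.isValue, Matrix.cons_val_zero, Matrix.cons_val_one] at ha
        obtain ⟨h0, h1⟩ := dvd_of_zsmul_add_zsmul_eq_zero_of_ne_socle hx2 hx0 hκ hy hxy ha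
        rw [hord i]
        fin_cases i
        · exact h0
        · exact h1)
      (fun a ha ↦ by
        simp only [Fin.sum_univ_two, Fin.isValue, Matrix.cons_val_zero, Matrix.cons_val_one] at ha ⊢
        exact hres (a 0) (a 1) ha)
      ![1, κ] hord ![1, κ]
      (fun i ↦ by fin_cases i <;> exact le_rfl) (fun _ ↦ rfl)
    refine hQ.mono fun ℓ hℓ ↦ ⟨hℓ.1, hℓ.2.1, hℓ.2.2.1, fun v hv ↦ ⟨fun hxv ↦ ?_, fun j ↦ ?_⟩⟩
    · have h := hℓ.2.2.2 0 v hv 0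
      rw [pow_zero, Nat.cast_one, one_smul] at h
      exact absurd (h.mp hxv) (by simp)
    · have h := hℓ.2.2.2 1 v hv j
      simpa using h

end Chebotarev

end Summit.BirchSwinnertonDyer.BirchSwinnertonDyer.Theorems.GenusExact.PlusDescent

end
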